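import Summits.CriticalPhenomena.PercolationContinuityZ3.Theorems.PercNecklaceBackboneTruncatedSusceptibilityFiniteOfThetaOfBlockingFamily
import Summits.CriticalPhenomena.PercolationContinuityZ3.Theorems.PercRayRenewalJumpLineAvoidanceDecaySummitEquivalence
import HarnessLib

/-!
# Crux `TruncatedSusceptibilityFiniteOfTheta` (stmt-CriticalPhenomena-0852) meets route `PercRayRenewal`:
# the crux, and its registered stub, ARE the conjunct `θ(p_c) = 0` modulo the two-arms ratio law T2

Lead prover-line-stmt-CriticalPhenomena-0852-c4-0 (line `registered`, continuation c4), 2026-08-17.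
Bond percolation on `ℤ³` at `p_c`; `E_n = siteToBoundary 3 n \ percolatesAt 0 = {0 ↔ ∂Λ_n in Λ_n, |C(0)| < ∞}`,
`g(n) = P_{p_c}(E_n)`; `τᶠ(0,x) = P_{p_c}(0 ↔ x, |C(0)| < ∞)`, `χᶠ(p_c) = Σ_x τᶠ(0,x)`.

Route `PercRayRenewal` (Kozma–Nitzan 2024 §1 items 4–5 made into a checked criterion: BGN shattering of the
infinite cluster by half-spaces + renewal along a ray) has the PROVED assembly
`percRayRenewalAssembly_proof : TwoArmsRatioExponent → JumpLineAvoidanceDecay → θ(p_c) = 0` and the proved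
equivalence `JumpLineAvoidanceDecay ↔ JumpTruncatedOneArmDecay` (G ↔ G1′), where
G1′ = `θ(p_c) > 0 ⇒ ∃ a > 0, C: g(n) ≤ C n^{-a}` (ANY power). This file supplies the missing cross-route edges:

* `jumpTruncatedOneArmDecay_of_truncatedSusceptibility_critical` — **L(p_c) ⇒ G1′ with `a = 1`**:
  `(n+1) g(n) ≤ Σ_{x∈Λ_n} τᶠ(0,x) ≤ χᶠ(p_c)` (`succ_mul_real_finiteArm_le_sum`, p158555), so `g(n) ≤ χᶠ · n⁻¹`;
* `jumpTruncatedOneArmDecay_of_radiusMoment` — the CONCLUSION of the registered stub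
  (`Σ (n+1)² g(n) < ∞`) ⇒ G1′ with `a = 2` (`(n+1)² g(n) ≤ Σ`), and `jumpTruncatedOneArmDecay_of_criticalRadiusMoment`
  (the stub as registered ⇒ G1′);
* `jumpTruncatedOneArmDecay_of_TruncatedSusceptibilityFiniteOfTheta` (three route spellings) and
  `jumpLineAvoidanceDecay_of_TruncatedSusceptibilityFiniteOfTheta` — **crux 0852 ⇒ G1′ ⇒ G** (cruxes #4, #3 of
  `PercRayRenewal`, stmt-4627 / stmt-4626);
* CERTIFICATES: `TruncatedSusceptibilityFiniteOfTheta_iff_summit_of_twoArmsRatioExponent` (′, ″) —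
  **`TwoArmsRatioExponent → (TruncatedSusceptibilityFiniteOfTheta ↔ PercolationContinuityZ3)`**, and
  `stub_criticalRadiusMoment_iff_summit_of_twoArmsRatioExponent` — the same for the registered stub;
* riders `summit_of_twoArmsRatioExponent_of_{crux, FiniteRadiusExpDecayOfTheta, FiniteClusterVolumeTail,
  FiniteClusterMomentsOfTheta, thinDust}`: **T2 together with ANY thin-critical-dust item (0852, 0853, 0943, 6065,
  7204.thinDust) closes the conjunct** — the jump-world crux G of `PercRayRenewal` may be replaced by the weakest
  thin-dust statement `χᶠ(p_c) < ∞`.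

Together with the c3 certificates (p158555/p158780/p159081: crux ⟺ summit modulo `Σ u_n(p_c) = ∞ ∨ u_n ≠ O(1/n)`,
`SubpolynomialBlocking → (crux ↔ summit)`), crux 0852 is now certified circular in every world satisfying EITHER a
polynomially visible critical annulus blocking OR the two-arms ratio law `P_{p_c}(A₂(r,n)) ≤ C (r/n)^{c₂}`, `c₂ > 1`
(van den Berg–van Engelenburg's `A₂`; heuristically `c₂ = d − 1/ν ≈ 1.86`). No new definitions; no sorry.
-/

noncomputable section

namespace Summit.CriticalPhenomena.PercolationContinuityZ3.Theorems.TruncatedSusceptibilityFiniteOfTheta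

open MeasureTheory Filter Topology
open Literature.Probability.Percolation Literature.Probability.LatticeModels

/-! ## §1 Thin critical dust gives the power-law one-arm decay of route `PercRayRenewal` -/

/-- **`L(p_c) ⇒ G1′` with exponent `a = 1`.** If `θ(p_c) > 0 ⇒ χᶠ(p_c) < ∞` then
`JumpTruncatedOneArmDecay`: in the jump world `(n+1) · P_{p_c}(0 ↔ ∂Λ_n, |C(0)| < ∞) ≤ Σ_{x∈Λ_n} τᶠ(0,x) ≤ χᶠ(p_c)`
(an arm of a finite cluster meets `n+1` spheres, `succ_mul_real_finiteArm_le_sum`), hence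
`P_{p_c}(0 ↔ ∂Λ_n, |C(0)| < ∞) ≤ χᶠ(p_c) · n⁻¹` for `n ≥ 1`. [folklore] -/
theorem jumpTruncatedOneArmDecay_of_truncatedSusceptibility_critical
    (hL : 0 < theta (zdGraph 3) (0 : Site 3) (criticalProbI 3) →
      Summable fun x : Site 3 =>
        (bondPercolation (zdGraph 3) (criticalProbI 3)).real (openConn 0 x \ percolatesAt 0)) :
    Summit.CriticalPhenomena.PercolationContinuityZ3.Theses.PercRayRenewal.JumpTruncatedOneArmDecay := by
  unfold Summit.CriticalPhenomena.PercolationContinuityZ3.Theses.PercRayRenewal.JumpTruncatedOneArmDecay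
  intro hθ
  have hchi := hL hθ
  refine ⟨1, ∑' x : Site 3,
      (bondPercolation (zdGraph 3) (criticalProbI 3)).real (openConn 0 x \ percolatesAt 0),
    one_pos, fun n hn => ?_⟩
  have hnpos : (0 : ℝ) < n := by exact_mod_cast hn
  have h1 := succ_mul_real_finiteArm_le_sum (criticalProbI 3) n
  have h2 : ∑ x ∈ box 3 n,
      (bondPercolation (zdGraph 3) (criticalProbI 3)).real (openConn 0 x \ percolatesAt 0) ≤
      ∑' x : Site 3, (bondPercolation (zdGraph 3) (criticalProbI 3)).real (openConn 0 x \ percolatesAt 0) :=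
    hchi.sum_le_tsum _ fun x _ => measureReal_nonneg
  have hg : 0 ≤ (bondPercolation (zdGraph 3) (criticalProbI 3)).real
      (siteToBoundary 3 n \ percolatesAt 0) := measureReal_nonneg
  have h12 := h1.trans h2
  rw [Real.rpow_neg hnpos.le, Real.rpow_one, ← div_eq_mul_inv, le_div_iff₀ hnpos]
  nlinarith [h12, hg]

/-- **`RM(p_c) ⇒ G1′` with exponent `a = 2`.** The CONCLUSION of the registered stub `stub_criticalRadiusMoment`,
`Σ_n (n+1)² P_{p_c}(0 ↔ ∂Λ_n, |C(0)| < ∞) < ∞`, bounds each term by the sum: `P_{p_c}(E_n) ≤ S/(n+1)² ≤ S · n⁻²`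
for `n ≥ 1` — the power-law radius tail `JumpTruncatedOneArmDecay` of route `PercRayRenewal` (its jump-world
hypothesis is not even used). [folklore] -/
theorem jumpTruncatedOneArmDecay_of_radiusMoment
    (hRM : Summable fun n : ℕ => ((n : ℝ) + 1) ^ 2 *
        (bondPercolation (zdGraph 3) (criticalProbI 3)).real (siteToBoundary 3 n \ percolatesAt 0)) :
    Summit.CriticalPhenomena.PercolationContinuityZ3.Theses.PercRayRenewal.JumpTruncatedOneArmDecay := by
  unfold Summit.CriticalPhenomena.PercolationContinuityZ3.Theses.PercRayRenewal.JumpTruncatedOneArmDecay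
  intro _
  set S := ∑' n : ℕ, ((n : ℝ) + 1) ^ 2 *
      (bondPercolation (zdGraph 3) (criticalProbI 3)).real (siteToBoundary 3 n \ percolatesAt 0) with hS
  refine ⟨2, S, two_pos, fun n hn => ?_⟩
  have hnpos : (0 : ℝ) < n := by exact_mod_cast hn
  have hg : 0 ≤ (bondPercolation (zdGraph 3) (criticalProbI 3)).real
      (siteToBoundary 3 n \ percolatesAt 0) := measureReal_nonneg
  have hterm : ((n : ℝ) + 1) ^ 2 *
      (bondPercolation (zdGraph 3) (criticalProbI 3)).real (siteToBoundary 3 n \ percolatesAt 0) ≤ S :=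
    hRM.le_tsum n fun m _ => mul_nonneg (by positivity) measureReal_nonneg
  rw [Real.rpow_neg hnpos.le, Real.rpow_two, ← div_eq_mul_inv, le_div_iff₀ (by positivity)]
  have hsq : (n : ℝ) ^ 2 ≤ ((n : ℝ) + 1) ^ 2 := by nlinarith
  calc (bondPercolation (zdGraph 3) (criticalProbI 3)).real (siteToBoundary 3 n \ percolatesAt 0) * (n : ℝ) ^ 2
      ≤ (bondPercolation (zdGraph 3) (criticalProbI 3)).real (siteToBoundary 3 n \ percolatesAt 0) *
          ((n : ℝ) + 1) ^ 2 := mul_le_mul_of_nonneg_left hsq hg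
    _ = ((n : ℝ) + 1) ^ 2 *
          (bondPercolation (zdGraph 3) (criticalProbI 3)).real (siteToBoundary 3 n \ percolatesAt 0) := by ring
    _ ≤ S := hterm

/-- **The registered stub implies G1′**: `stub_criticalRadiusMoment` (as registered: `θ(p_c) > 0 ⇒ RM(p_c)`) gives
`JumpTruncatedOneArmDecay` (with `a = 2`). [folklore] -/
theorem jumpTruncatedOneArmDecay_of_criticalRadiusMoment
    (h2 : 0 < theta (zdGraph 3) (0 : Site 3) (criticalProbI 3) →
      Summable fun n : ℕ => ((n : ℝ) + 1) ^ 2 *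
        (bondPercolation (zdGraph 3) (criticalProbI 3)).real (siteToBoundary 3 n \ percolatesAt 0)) :
    Summit.CriticalPhenomena.PercolationContinuityZ3.Theses.PercRayRenewal.JumpTruncatedOneArmDecay := by
  unfold Summit.CriticalPhenomena.PercolationContinuityZ3.Theses.PercRayRenewal.JumpTruncatedOneArmDecay
  intro hθ
  exact jumpTruncatedOneArmDecay_of_radiusMoment (h2 hθ) hθ

/-! ## §2 Crux 0852 implies cruxes G1′ and G of route `PercRayRenewal` -/

/-- **Crux 0852 ⇒ G1′** (`TruncatedSusceptibilityFiniteOfTheta → JumpTruncatedOneArmDecay`, stmt-4627): the crux at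
`p = p_c` is `θ(p_c) > 0 ⇒ χᶠ(p_c) < ∞`. [folklore] -/
theorem jumpTruncatedOneArmDecay_of_TruncatedSusceptibilityFiniteOfTheta
    (hL : Summit.CriticalPhenomena.PercolationContinuityZ3.Theses.PercNecklaceBackbone.TruncatedSusceptibilityFiniteOfTheta) :
    Summit.CriticalPhenomena.PercolationContinuityZ3.Theses.PercRayRenewal.JumpTruncatedOneArmDecay :=
  jumpTruncatedOneArmDecay_of_truncatedSusceptibility_critical (hL (criticalProbI 3))

/-- The same edge from the home-route spelling (`PercTruncatedSusceptibility`; shared item, identical text). [folklore] -/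
theorem jumpTruncatedOneArmDecay_of_TruncatedSusceptibilityFiniteOfTheta'
    (hL : Summit.CriticalPhenomena.PercolationContinuityZ3.Theses.PercTruncatedSusceptibility.TruncatedSusceptibilityFiniteOfTheta) :
    Summit.CriticalPhenomena.PercolationContinuityZ3.Theses.PercRayRenewal.JumpTruncatedOneArmDecay :=
  jumpTruncatedOneArmDecay_of_TruncatedSusceptibilityFiniteOfTheta hL

/-- The same edge from the `PercAntiMeanFieldOnset` spelling (shared item, identical text). [folklore] -/
theorem jumpTruncatedOneArmDecay_of_TruncatedSusceptibilityFiniteOfTheta''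
    (hL : Summit.CriticalPhenomena.PercolationContinuityZ3.Theses.PercAntiMeanFieldOnset.TruncatedSusceptibilityFiniteOfTheta) :
    Summit.CriticalPhenomena.PercolationContinuityZ3.Theses.PercRayRenewal.JumpTruncatedOneArmDecay :=
  jumpTruncatedOneArmDecay_of_TruncatedSusceptibilityFiniteOfTheta hL

/-- **Crux 0852 ⇒ G** (`TruncatedSusceptibilityFiniteOfTheta → JumpLineAvoidanceDecay`, stmt-4626): through G1′ and
the landed box chain `boxChainLineAvoidance_proof : G1′ → G`. In the jump world with `χᶠ(p_c) < ∞` the axis segment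
`e₀, …, m e₀` misses the infinite cluster with probability `≤ C m^{-κ}`. [folklore] -/
theorem jumpLineAvoidanceDecay_of_TruncatedSusceptibilityFiniteOfTheta
    (hL : Summit.CriticalPhenomena.PercolationContinuityZ3.Theses.PercNecklaceBackbone.TruncatedSusceptibilityFiniteOfTheta) :
    Summit.CriticalPhenomena.PercolationContinuityZ3.Theses.PercRayRenewal.JumpLineAvoidanceDecay :=
  jumpLineAvoidanceDecay_iff_jumpTruncatedOneArmDecay.2
    (jumpTruncatedOneArmDecay_of_TruncatedSusceptibilityFiniteOfTheta hL)

/-! ## §3 Certificates: modulo T2, the crux and its stub are the conjunct -/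

/-- **`TwoArmsRatioExponent → (TruncatedSusceptibilityFiniteOfTheta ↔ PercolationContinuityZ3)`.** Given the two-arms
ratio law T2 of route `PercRayRenewal` (stmt-4625: `P_{p_c}(A₂(r,n)) ≤ C (r/n)^{c₂}`, `c₂ > 1`, an unconditional
statement at `p_c(ℤ³)`), crux 0852 holds iff `θ(p_c) = 0`: (⇒) crux ⇒ G1′ ⇒ G and the proved ray-renewal assembly
`percRayRenewalAssembly_proof`; (⇐) `TruncatedSusceptibilityFiniteOfTheta_of_percolationContinuity` (vacuous live
case + landed supercritical regime, p153838). [folklore] -/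
theorem TruncatedSusceptibilityFiniteOfTheta_iff_summit_of_twoArmsRatioExponent
    (hT2 : Summit.CriticalPhenomena.PercolationContinuityZ3.Theses.PercRayRenewal.TwoArmsRatioExponent) :
    Summit.CriticalPhenomena.PercolationContinuityZ3.Theses.PercNecklaceBackbone.TruncatedSusceptibilityFiniteOfTheta ↔
      _root_.PercolationContinuityZ3 :=
  ⟨fun hL => (jumpTruncatedOneArmDecay_iff_percolationContinuityZ3 hT2).1
      (jumpTruncatedOneArmDecay_of_TruncatedSusceptibilityFiniteOfTheta hL),
    fun h => TruncatedSusceptibilityFiniteOfTheta_of_percolationContinuity h⟩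

/-- The same certificate in the home-route spelling (`PercTruncatedSusceptibility`). [folklore] -/
theorem TruncatedSusceptibilityFiniteOfTheta_iff_summit_of_twoArmsRatioExponent'
    (hT2 : Summit.CriticalPhenomena.PercolationContinuityZ3.Theses.PercRayRenewal.TwoArmsRatioExponent) :
    Summit.CriticalPhenomena.PercolationContinuityZ3.Theses.PercTruncatedSusceptibility.TruncatedSusceptibilityFiniteOfTheta ↔
      _root_.PercolationContinuityZ3 :=
  TruncatedSusceptibilityFiniteOfTheta_iff_summit_of_twoArmsRatioExponent hT2

/-- The same certificate in the `PercAntiMeanFieldOnset` spelling. [folklore] -/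
theorem TruncatedSusceptibilityFiniteOfTheta_iff_summit_of_twoArmsRatioExponent''
    (hT2 : Summit.CriticalPhenomena.PercolationContinuityZ3.Theses.PercRayRenewal.TwoArmsRatioExponent) :
    Summit.CriticalPhenomena.PercolationContinuityZ3.Theses.PercAntiMeanFieldOnset.TruncatedSusceptibilityFiniteOfTheta ↔
      _root_.PercolationContinuityZ3 :=
  TruncatedSusceptibilityFiniteOfTheta_iff_summit_of_twoArmsRatioExponent hT2

/-- **`TwoArmsRatioExponent → (stub_criticalRadiusMoment ↔ PercolationContinuityZ3)`**: modulo T2 the one open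
registered stub of the line `registered` IS the conjunct — (⇒) stub ⇒ G1′ (`a = 2`) ⇒ `θ(p_c) = 0`
(`jumpTruncatedOneArmDecay_iff_percolationContinuityZ3`); (⇐) vacuity (`stub_criticalRadiusMoment_of_percolationContinuity`).
Compare `criticalRadiusMoment_iff_summit_of_not_summable_blocking` (p158555): the same conclusion modulo
non-summable critical annulus blocking. [folklore] -/
theorem stub_criticalRadiusMoment_iff_summit_of_twoArmsRatioExponent : Summit.CriticalPhenomena.PercolationContinuityZ3.Theses.PercRayRenewal.TwoArmsRatioExponent → ((0 < Literature.Probability.Percolation.theta (Literature.Probability.LatticeModels.zdGraph 3) (0 : Literature.Probability.LatticeModels.Site 3) (Literature.Probability.Percolation.criticalProbI 3) → Summable fun n : ℕ => ((n : ℝ) + 1) ^ 2 * (Literature.Probability.Percolation.bondPercolation (Literature.Probability.LatticeModels.zdGraph 3) (Literature.Probability.Percolation.criticalProbI 3)).real (Literature.Probability.Percolation.siteToBoundary 3 n \ Literature.Probability.Percolation.percolatesAt 0)) ↔ Literature.Probability.Percolation.PercolationContinuityZ3) := by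
  intro hT2
  exact ⟨fun h2 => (jumpTruncatedOneArmDecay_iff_percolationContinuityZ3 hT2).1
      (jumpTruncatedOneArmDecay_of_criticalRadiusMoment h2),
    fun h => stub_criticalRadiusMoment_of_percolationContinuity h⟩

/-! ## §4 Riders: T2 with any thin-critical-dust item closes the conjunct -/

/-- **T2 ∧ crux 0852 ⇒ `θ(p_c) = 0`.** [folklore] -/
theorem summit_of_twoArmsRatioExponent_of_crux
    (hT2 : Summit.CriticalPhenomena.PercolationContinuityZ3.Theses.PercRayRenewal.TwoArmsRatioExponent)
    (hL : Summit.CriticalPhenomena.PercolationContinuityZ3.Theses.PercNecklaceBackbone.TruncatedSusceptibilityFiniteOfTheta) :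
    _root_.PercolationContinuityZ3 :=
  (TruncatedSusceptibilityFiniteOfTheta_iff_summit_of_twoArmsRatioExponent hT2).1 hL

/-- **T2 ∧ crux 0853 (`FiniteRadiusExpDecayOfTheta`) ⇒ `θ(p_c) = 0`.** [folklore] -/
theorem summit_of_twoArmsRatioExponent_of_FiniteRadiusExpDecayOfTheta
    (hT2 : Summit.CriticalPhenomena.PercolationContinuityZ3.Theses.PercRayRenewal.TwoArmsRatioExponent)
    (h : Summit.CriticalPhenomena.PercolationContinuityZ3.Theses.PercTruncatedSusceptibility.FiniteRadiusExpDecayOfTheta) :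
    _root_.PercolationContinuityZ3 :=
  summit_of_twoArmsRatioExponent_of_crux hT2 (TruncatedSusceptibilityFiniteOfTheta_of_FiniteRadiusExpDecayOfTheta h)

/-- **T2 ∧ crux 0943 (`FiniteClusterVolumeTail`, Kesten–Zhang tails at `p_c`) ⇒ `θ(p_c) = 0`** — compare
`FreeBoxSparse.Quarantine.percolationContinuityZ3_of_subpolynomialBlocking_of_finiteClusterVolumeTail`
(crux 4446 in place of T2). [folklore] -/
theorem summit_of_twoArmsRatioExponent_of_FiniteClusterVolumeTail
    (hT2 : Summit.CriticalPhenomena.PercolationContinuityZ3.Theses.PercRayRenewal.TwoArmsRatioExponent)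
    (h : Summit.CriticalPhenomena.PercolationContinuityZ3.Theses.PercDebrisSweep.FiniteClusterVolumeTail) :
    _root_.PercolationContinuityZ3 :=
  summit_of_twoArmsRatioExponent_of_crux hT2 (TruncatedSusceptibilityFiniteOfTheta_of_FiniteClusterVolumeTail h)

/-- **T2 ∧ crux 6065 (`FiniteClusterMomentsOfTheta`) ⇒ `θ(p_c) = 0`.** [folklore] -/
theorem summit_of_twoArmsRatioExponent_of_FiniteClusterMomentsOfTheta
    (hT2 : Summit.CriticalPhenomena.PercolationContinuityZ3.Theses.PercRayRenewal.TwoArmsRatioExponent)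
    (h : Summit.CriticalPhenomena.PercolationContinuityZ3.Theses.PercVarianceSandwich.FiniteClusterMomentsOfTheta) :
    _root_.PercolationContinuityZ3 :=
  summit_of_twoArmsRatioExponent_of_crux hT2 (TruncatedSusceptibilityFiniteOfTheta_of_FiniteClusterMomentsOfTheta h)

/-- **T2 ∧ superpolynomial thin dust (stub `stub_thinDust` of crux 7204) ⇒ `θ(p_c) = 0`.** [folklore] -/
theorem summit_of_twoArmsRatioExponent_of_thinDust
    (hT2 : Summit.CriticalPhenomena.PercolationContinuityZ3.Theses.PercRayRenewal.TwoArmsRatioExponent)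
    (hdust : 0 < theta (zdGraph 3) (0 : Fin 3 → ℤ) (criticalProbI 3) →
      ∀ k : ℕ, ∃ C : ℝ, ∀ n : ℕ,
        (bondPercolation (zdGraph 3) (criticalProbI 3)).real (siteToBoundary 3 n \ percolatesAt 0) ≤
          C / ((n : ℝ) + 1) ^ k) :
    _root_.PercolationContinuityZ3 :=
  (stub_criticalRadiusMoment_iff_summit_of_twoArmsRatioExponent hT2).1 (stub_criticalRadiusMoment_of_thinDust hdust)

end Summit.CriticalPhenomena.PercolationContinuityZ3.Theorems.TruncatedSusceptibilityFiniteOfTheta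

end
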